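import Summits.AtomisticToContinuum.HydrodynamicLimit.Theses.BallwiseInvariantReferences

/-!
# Birth skeleton (BC3) for the crux `BallwiseInvariantReferences.LocalFluxGibbsianity`
(stmt-AtomisticToContinuum-13021; registrar planner-skel-stmt-AtomisticToContinuum-13021-0, 2026-08-17)

The crux (LFG, "local flux-Gibbsianity in pressure form") says that the window pressure
`Λ_M = (M+1)⁻¹ log ∫ exp(X) dG_M` of the block-recentred, velocity-truncated, collision-resolved
current functional `X` under the homogeneous flow-invariant canonical hard-sphere Gibbs law `G_M`
has `limsup_M Λ_M ≤ δ` for every `δ > 0` once `K` (speed cut), then `L` (window), then `k` (block)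
are large, for all smooth test fields of sup-norm `≤ β₀`.

## The seam of this skeleton = the seam of the standing paper refutation

Two independent refuter passes on this item (evidence `EVIDENCE.md` sha 428ea41c, `EVIDENCE_g2.md`
sha 243d99b9; route review `REVIEW_BallwiseInvariantReferences.md`) argue that LFG **as typed** is
refuted-MISSTATED: for the isotropic test tensor `A_j = β₀ e_j` a macroscopic near-jammed cluster
(fraction `f`, relative gap `α'`) earns collisional virial `≈ 3β₀θ/α'` per particle per unit time
(caging), survives the micro window (rarefaction depth `√θ L (M+1)^{-1/3}/α' → 0`), and costs only
`3 log(1/α') + 3 log(1/σ') + O(1)` per particle under `G_M`, while the recentring pressure is capped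
at `Z(min(ρ̄,2)σ'³)`; hence `limsup_M Λ_M = +∞` for every `σ₀, β₀, K, L, k`.  No Negative lemma has
landed (no `Disproof.lean`, item open), so the crux stands as filed and this skeleton concludes it BY
NAME — but it is cut exactly along that seam, so that it types the repair:

* `stub_visibleWindowPressure` — the SURVIVING content: the same pressure bound for the functional
  restricted to VISIBLE particles, `vis := ‖v_i‖ ≤ K ∧ (uncut cone-kernel density at the mesoscopic
  scale R·(M+1)^{-1/3} around x_i) ≤ 3/2`, with `R ≥ K₀` quantified TOGETHER WITH `K`, i.e. BEFORE the
  window `L` (order `K,R → L → k`).  Both recorded witnesses miss it: macroscopic jammed clusters are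
  invisible (scale-`R` density `≥ √2/(8σ'³) > 3/2` even at an octant corner, for `σ' ≤ 0.4`); a
  VISIBLE jammed particle has at most the volume fraction `1.06 σ'³` of its `R`-ball jammed, so it
  lies within `≲ R` layers (compact droplet) / `≲ 1.4 R σ'²` layers (slab) of a free surface, its cage
  dies by rarefaction (speed `√θ/α'`) within `≲ R ε α'/√θ`, and its window-averaged virial gain is
  `≤ c β₀ √θ σ' R / L → 0` per particle as `L → ∞` AFTER `R` (the g2 computation, `0.45 k ↦ R`), at
  Gibbs cost `≥ 3 log(1/σ')` per particle; the invisibility bias of equilibrium density fluctuations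
  is `O(β₀ θ σ'³ e^{-cR³}) → 0` because `R ≥ K₀(δ)`.  (The refuters' own repair `C‴` cuts at the block
  scale `k` and puts the window LAST; either is a candidate for the repaired item
  `LocalFluxGibbsianityR` — the tenure planner's call, not this registrar's.)
* `stub_denseRemainderPressure` — the REFUTED remainder: the same pressure bound for the complementary
  functional `2(X − X_vis)` (dense/invisible particles' currents and collisional transfers).  This is
  where the jammed-cluster witness bites (all cluster particles are invisible, their virial sits here):
  it is the named formal target for a disprover (`¬ stub_denseRemainderPressure` is the Negative lemma
  "HardCoreVirialEntropyMismatch" of EVIDENCE_g2 §7, and it closes 13021 refuted-misstated).  Any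
  repair of 13021 deletes or re-types exactly this piece (and hands the dense throughput to an
  `f_t`-side tail item of BallwiseSufficiency, 13023).
* `stub_exponentialCauchySchwarz` — the TRUE analytic split: `Λ_M(X) ≤ max(Λ_M(2X_vis), Λ_M(2(X−X_vis)))`
  (Cauchy–Schwarz for `∫ e^{X_vis} e^{X−X_vis} dG_M`, `√(ab) ≤ max(a,b)`, monotonicity of
  `(M+1)⁻¹ log`); its content is the `G_M`-measurability of the collision-resolved path functionals
  (progressive measurability of the càdlàg hard-sphere flow on its good set).

`LocalFluxGibbsianity_of : LocalFluxGibbsianity` invokes the three stubs BY NAME through the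
sorry-free hypothesis form `fullPressureVanishes_of : stub₁-sig → stub₂-sig → stub₃-sig →
PressureVanishes (pressureOf fullExponent)` and `crux_iff : LocalFluxGibbsianity ↔ PressureVanishes
(pressureOf fullExponent)`, which is `Iff.rfl` (the crux body, restated through named functionals);
`pressureVanishes_of_split` is the generic threshold bookkeeping (`σ₀, β₀ := min`, `K₀, L₀, k₀ := max`,
`R := K`) plus `limsup c ≤ limsup (max a b) = max (limsup a) (limsup b)`.  `sorry` occurs only inside
the three `stub_*`.

Disproof used: none landed (`ledger crux ls` empty at registration); the paper witnesses above are
honoured by isolation (they refute `stub_denseRemainderPressure` and nothing else in this file).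
-/

noncomputable section

namespace Summit.AtomisticToContinuum.HydrodynamicLimit.Cruxes.LocalFluxGibbsianity.Birth

open scoped BigOperators Topology Manifold Classical MeasureTheory ProbabilityTheory Matrix InnerProductSpace ComplexConjugate ContinuousMap
open Filter Set Function TopologicalSpace MeasureTheory

/-! ## Named functionals (the crux body, restated) -/

/-- Phase points of `M+1` spheres on `𝕋³`. -/
abbrev Cfg (M : ℕ) := Fin (M + 1) → UnitAddTorus (Fin 3) × EuclideanSpace ℝ (Fin 3)

/-- Families of hard-sphere flows of `M+1` spheres of diameter `ε M` on `𝕋³`. -/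
abbrev FlowFamily (ε : ℕ → ℝ) :=
  (M : ℕ) → Literature.Analysis.FluidPDE.HardSphereFlow
    (Literature.Analysis.FluidPDE.Torus.geometry (Fin 3)) (ε M) (M + 1)

/-- Exponent families `X(σ', θ, u, ε, Φ, A₀, A₄, A, K, L, k, M; z) : ℝ`. -/
abbrev ExponentFamily :=
  (σ' θ : ℝ) → (u : EuclideanSpace ℝ (Fin 3)) → (ε : ℕ → ℝ) → FlowFamily ε →
    (A₀ A₄ : UnitAddTorus (Fin 3) → EuclideanSpace ℝ (Fin 3)) →
    (A : Fin 3 → UnitAddTorus (Fin 3) → EuclideanSpace ℝ (Fin 3)) → (K L k : ℝ) → (M : ℕ) → Cfg M → ℝ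

/-- Pressure families `Λ(σ', θ, u, ε, Φ, A₀, A₄, A, K, L, k, M) : EReal`. -/
abbrev PressureFamily :=
  (σ' θ : ℝ) → (u : EuclideanSpace ℝ (Fin 3)) → (ε : ℕ → ℝ) → FlowFamily ε →
    (A₀ A₄ : UnitAddTorus (Fin 3) → EuclideanSpace ℝ (Fin 3)) →
    (A : Fin 3 → UnitAddTorus (Fin 3) → EuclideanSpace ℝ (Fin 3)) → (K L k : ℝ) → ℕ → EReal

/-- The homogeneous flow-invariant canonical hard-sphere Gibbs law `G_M` (activity 1, drift `u`,
temperature `θ`, diameter `ε M`) — the reference measure of the crux. -/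
def gibbsLaw (θ : ℝ) (u : EuclideanSpace ℝ (Fin 3)) (ε : ℕ → ℝ) (Φ : FlowFamily ε) (M : ℕ) :
    Measure (Cfg M) :=
  Literature.Analysis.FluidPDE.particleLaw (Φ M) (Literature.Analysis.FluidPDE.canonicalDensity (Literature.Analysis.FluidPDE.Torus.geometry (Fin 3)) (ε M) (M + 1) (Literature.MathematicalPhysics.KineticTheory.localGibbsProfile (fun _ => 1) (fun _ => u) (fun _ => θ)))

/-- The window pressure of an exponent family: `(M+1)⁻¹ log ∫ exp(X) dG_M` in `EReal`. -/
def pressureOf (X : ExponentFamily) : PressureFamily := fun σ' θ u ε Φ A₀ A₄ A K L k M =>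
  ((((M : ℝ) + 1)⁻¹ : ℝ) : EReal) * ENNReal.log (∫⁻ z, ENNReal.ofReal (Real.exp (X σ' θ u ε Φ A₀ A₄ A K L k M z)) ∂(gibbsLaw θ u ε Φ M))

/-- The crux's exponent `X = τ⁻¹ [∫₀^τ kin + Σ_coll coll − ∫₀^τ flux]` — VERBATIM the body of
`BallwiseInvariantReferences.LocalFluxGibbsianity` (so that `crux_iff` is `Iff.rfl`). -/
def fullExponent : ExponentFamily := fun σ' _θ _u ε Φ A₀ A₄ A K L k M z =>
  let τ : ℝ := L * ((M : ℝ) + 1) ^ (-(1 / 3 : ℝ)); let bk : UnitAddTorus (Fin 3) → UnitAddTorus (Fin 3) → ℝ := fun x y => 3 / (Real.pi * (k * ((M : ℝ) + 1) ^ (-(1 / 3 : ℝ))) ^ 3) * max 0 (1 - Literature.Analysis.FluidPDE.Torus.euclidDist x y / (k * ((M : ℝ) + 1) ^ (-(1 / 3 : ℝ)))); let kin : (Fin (M + 1) → UnitAddTorus (Fin 3) × EuclideanSpace ℝ (Fin 3)) → ℝ := fun z => ∑ i, if ‖(z i).2‖ ≤ K then ⟪A₀ (z i).1, (z i).2⟫_ℝ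 + (∑ j, ⟪A j (z i).1, (z i).2⟫_ℝ * (z i).2 j) + ⟪A₄ (z i).1, (z i).2⟫_ℝ * ‖(z i).2‖ ^ 2 / 2 else 0; let coll : (Fin (M + 1) → UnitAddTorus (Fin 3) × EuclideanSpace ℝ (Fin 3)) → (Fin (M + 1) → UnitAddTorus (Fin 3) × EuclideanSpace ℝ (Fin 3)) → ℝ := fun zl zr => ∑ i, (let Δ : EuclideanSpace ℝ (Fin 3) := (zr i).2 - (zl i).2; let ω : EuclideanSpace ℝ (Fin 3) := ‖Δ‖⁻¹ • Δ; if ‖(zl i).2‖ ≤ K ∧ ‖(zr i).2‖ ≤ K then ε M / 2 * ∫ r in (0 : ℝ)..1, ((∑ j, ⟪A j ((zr i).1 + Literature.Analysis.FunctionSpaces.Torus.proj (-(r * ε M) • ω)), ω⟫_ℝ * Δ j) + ⟪A₄ ((zr i).1 + Literature.Analysis.FunctionSpaces.Torus.proj (-(r * ε M) • ω)), ω⟫_ℝ * (‖(zr i).2‖ ^ 2 - ‖(zl i).2‖ ^ 2) / 2) else 0); let flux : (Fin (M + 1) → UnitAddTorus (Fin 3) × EuclideanSpace ℝ (Fin 3))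 → ℝ := fun z => ((M : ℝ) + 1) * ∫ x, (let ρ : ℝ := ((M : ℝ) + 1)⁻¹ * ∑ i, (if ‖(z i).2‖ ≤ K then bk x (z i).1 else 0); let m : EuclideanSpace ℝ (Fin 3) := ((M : ℝ) + 1)⁻¹ • ∑ i, (if ‖(z i).2‖ ≤ K then bk x (z i).1 • (z i).2 else 0); let e : ℝ := ((M : ℝ) + 1)⁻¹ * ∑ i, (if ‖(z i).2‖ ≤ K then bk x (z i).1 * ‖(z i).2‖ ^ 2 / 2 else 0); let w : EuclideanSpace ℝ (Fin 3) := ρ⁻¹ • m; let p : ℝ := ρ * (2 / 3 * (e / ρ - ‖w‖ ^ 2 / 2)) * Literature.MathematicalPhysics.KineticTheory.hsCompressibility (min ρ 2 * σ' ^ 3); ⟪A₀ x, m⟫_ℝ + (∑ j, (⟪A j x, m⟫_ℝ * w j + p * A j x j)) + ⟪A₄ x, w⟫_ℝ * (e + p)); τ⁻¹ * ((∫ s in (0 : ℝ)..τ, kin ((Φ M).flow s z)) + (∑ᶠ s ∈ Literature.Analysis.FluidPDE.collisionTimes (Literature.Analysis.FluidPDE.Torus.geometry (Fin 3)) (ε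 M) (fun s => (Φ M).flow s z) ∩ Set.Ioc 0 τ, coll (Function.leftLim (fun s => (Φ M).flow s z) s) ((Φ M).flow s z)) - ∫ s in (0 : ℝ)..τ, flux ((Φ M).flow s z))

/-- The uncut cone-kernel at radius `a (M+1)^{-1/3}` (normalised: `∫ cone a M x · = 1`). -/
def cone (a : ℝ) (M : ℕ) (x y : UnitAddTorus (Fin 3)) : ℝ :=
  3 / (Real.pi * (a * ((M : ℝ) + 1) ^ (-(1 / 3 : ℝ))) ^ 3) * max 0 (1 - Literature.Analysis.FluidPDE.Torus.euclidDist x y / (a * ((M : ℝ) + 1) ^ (-(1 / 3 : ℝ))))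

/-- VISIBILITY of particle `i` in the configuration `z`: slow (`‖v_i‖ ≤ K`) AND locally dilute at
the mesoscopic scale `R (M+1)^{-1/3}`: the UNCUT cone-kernel density around `x_i` (all particles,
self included, normalised so that the mean density is `1`) is at most `3/2`.  Near-jammed clusters,
droplets and slabs thicker than `~ R σ'²` layers are invisible. -/
def Visible (R K : ℝ) (M : ℕ) (z : Cfg M) (i : Fin (M + 1)) : Prop :=
  ‖(z i).2‖ ≤ K ∧ ((M : ℝ) + 1)⁻¹ * ∑ j, cone R M (z i).1 (z j).1 ≤ 3 / 2

instance (R K : ℝ) (M : ℕ) (z : Cfg M) (i : Fin (M + 1)) : Decidable (Visible R K M z i) :=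
  Classical.dec _

/-- The VISIBLE core `X_vis`: the crux's functional with every per-particle indicator
`‖v_i‖ ≤ K` replaced by `Visible R K` (in `kin`; for both the pre- and post-collisional state in
`coll`; and inside the block fields `ρ̄, m̄, ē` of `flux`, which are then the fields of the visible
particles; equation of state `Z(min(ρ̄,2)σ'³)` kept, the cap now inactive in the regime of interest). -/
def visCore (R : ℝ) : ExponentFamily := fun σ' _θ _u ε Φ A₀ A₄ A K L k M z =>
  let τ : ℝ := L * ((M : ℝ) + 1) ^ (-(1 / 3 : ℝ))
  let bk : UnitAddTorus (Fin 3) → UnitAddTorus (Fin 3) → ℝ := cone k M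
  let kin : Cfg M → ℝ := fun z => ∑ i, if Visible R K M z i then ⟪A₀ (z i).1, (z i).2⟫_ℝ + (∑ j, ⟪A j (z i).1, (z i).2⟫_ℝ * (z i).2 j) + ⟪A₄ (z i).1, (z i).2⟫_ℝ * ‖(z i).2‖ ^ 2 / 2 else 0
  let coll : Cfg M → Cfg M → ℝ := fun zl zr => ∑ i, (let Δ : EuclideanSpace ℝ (Fin 3) := (zr i).2 - (zl i).2; let ω : EuclideanSpace ℝ (Fin 3) := ‖Δ‖⁻¹ • Δ; if Visible R K M zl i ∧ Visible R K M zr i then ε M / 2 * ∫ r in (0 : ℝ)..1, ((∑ j, ⟪A j ((zr i).1 + Literature.Analysis.FunctionSpaces.Torus.proj (-(r * ε M) • ω)), ω⟫_ℝ * Δ j) + ⟪A₄ ((zr i).1 + Literature.Analysis.FunctionSpaces.Torus.proj (-(r * ε M) • ω)), ω⟫_ℝ * (‖(zr i).2‖ ^ 2 - ‖(zl i).2‖ ^ 2) / 2) else 0)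
  let flux : Cfg M → ℝ := fun z => ((M : ℝ) + 1) * ∫ x, (let ρ : ℝ := ((M : ℝ) + 1)⁻¹ * ∑ i, (if Visible R K M z i then bk x (z i).1 else 0); let m : EuclideanSpace ℝ (Fin 3) := ((M : ℝ) + 1)⁻¹ • ∑ i, (if Visible R K M z i then bk x (z i).1 • (z i).2 else 0); let e : ℝ := ((M : ℝ) + 1)⁻¹ * ∑ i, (if Visible R K M z i then bk x (z i).1 * ‖(z i).2‖ ^ 2 / 2 else 0); let w : EuclideanSpace ℝ (Fin 3) := ρ⁻¹ • m; let p : ℝ := ρ * (2 / 3 * (e / ρ - ‖w‖ ^ 2 / 2)) * Literature.MathematicalPhysics.KineticTheory.hsCompressibility (min ρ 2 * σ' ^ 3); ⟪A₀ x, m⟫_ℝ + (∑ j, (⟪A j x, m⟫_ℝ * w j + p * A j x j)) + ⟪A₄ x, w⟫_ℝ * (e + p))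
  τ⁻¹ * ((∫ s in (0 : ℝ)..τ, kin ((Φ M).flow s z)) + (∑ᶠ s ∈ Literature.Analysis.FluidPDE.collisionTimes (Literature.Analysis.FluidPDE.Torus.geometry (Fin 3)) (ε M) (fun s => (Φ M).flow s z) ∩ Set.Ioc 0 τ, coll (Function.leftLim (fun s => (Φ M).flow s z) s) ((Φ M).flow s z)) - ∫ s in (0 : ℝ)..τ, flux ((Φ M).flow s z))

/-- The doubled visible exponent `2 X_vis` (doubling = the Cauchy–Schwarz exponent; immaterial for
the stub since `X_vis` is linear in the test fields and `β₀` is existential). -/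
def visExponent (R : ℝ) : ExponentFamily := fun σ' θ u ε Φ A₀ A₄ A K L k M z =>
  2 * visCore R σ' θ u ε Φ A₀ A₄ A K L k M z

/-- The doubled DENSE REMAINDER `2 (X − X_vis)`: currents and collisional transfers of the
invisible (fast or locally dense) particles, recentred by the difference of the two block fluxes. -/
def remExponent (R : ℝ) : ExponentFamily := fun σ' θ u ε Φ A₀ A₄ A K L k M z =>
  2 * (fullExponent σ' θ u ε Φ A₀ A₄ A K L k M z - visCore R σ' θ u ε Φ A₀ A₄ A K L k M z)

/-- The crux's quantifier shell over a pressure family `P`: VERBATIM the prefix of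
`BallwiseInvariantReferences.LocalFluxGibbsianity` (order `∀δ ∃K₀ ∀K ∃L₀ ∀L ∃k₀ ∀k`). -/
def PressureVanishes (P : PressureFamily) : Prop :=
  ∃ σ₀ : ℝ, 0 < σ₀ ∧ ∀ (σlo σhi θlo θhi U : ℝ), 0 < σlo → σhi < σ₀ → 0 < θlo → ∃ β₀ : ℝ, 0 < β₀ ∧ ∀ σ' ∈ Set.Icc σlo σhi, ∀ θ ∈ Set.Icc θlo θhi, ∀ u : EuclideanSpace ℝ (Fin 3), ‖u‖ ≤ U → ∀ ε : ℕ → ℝ, (∀ M, 0 < ε M) → Filter.Tendsto (fun M : ℕ => ((M : ℝ) + 1) * ε M ^ 3) Filter.atTop (nhds (σ' ^ 3)) → ∀ Φ : (M : ℕ) → Literature.Analysis.FluidPDE.HardSphereFlow (Literature.Analysis.FluidPDE.Torus.geometry (Fin 3)) (ε M) (M + 1), ∀ (A₀ A₄ : UnitAddTorus (Fin 3) → EuclideanSpace ℝ (Fin 3)) (A : Fin 3 → UnitAddTorus (Fin 3) → EuclideanSpace ℝ (Fin 3)), Literature.Analysis.FunctionSpaces.Torus.IsSmooth A₀ → Literature.Analysis.FunctionSpaces.Torus.IsSmooth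 A₄ → (∀ k, Literature.Analysis.FunctionSpaces.Torus.IsSmooth (A k)) → (∀ x, ‖A₀ x‖ ≤ β₀) → (∀ x, ‖A₄ x‖ ≤ β₀) → (∀ k x, ‖A k x‖ ≤ β₀) → ∀ δ : ℝ, 0 < δ → ∃ K₀ : ℝ, ∀ K ≥ K₀, ∃ L₀ : ℝ, ∀ L ≥ L₀, ∃ k₀ : ℝ, ∀ k ≥ k₀, Filter.limsup (fun M : ℕ => P σ' θ u ε Φ A₀ A₄ A K L k M) Filter.atTop ≤ (δ : EReal)

/-- The same shell for an `R`-indexed pressure family, with the mesoscopic visibility scale `R`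
quantified TOGETHER WITH the speed cut and BEFORE the window:
`∀δ ∃K₀ ∀K ≥ K₀ ∀R ≥ K₀ ∃L₀ ∀L ∃k₀ ∀k`. -/
def PressureVanishesR (P : ℝ → PressureFamily) : Prop :=
  ∃ σ₀ : ℝ, 0 < σ₀ ∧ ∀ (σlo σhi θlo θhi U : ℝ), 0 < σlo → σhi < σ₀ → 0 < θlo → ∃ β₀ : ℝ, 0 < β₀ ∧ ∀ σ' ∈ Set.Icc σlo σhi, ∀ θ ∈ Set.Icc θlo θhi, ∀ u : EuclideanSpace ℝ (Fin 3), ‖u‖ ≤ U → ∀ ε : ℕ → ℝ, (∀ M, 0 < ε M) → Filter.Tendsto (fun M : ℕ => ((M : ℝ) + 1) * ε M ^ 3) Filter.atTop (nhds (σ' ^ 3)) → ∀ Φ : (M : ℕ) → Literature.Analysis.FluidPDE.HardSphereFlow (Literature.Analysis.FluidPDE.Torus.geometry (Fin 3)) (ε M) (M + 1), ∀ (A₀ A₄ : UnitAddTorus (Fin 3) → EuclideanSpace ℝ (Fin 3)) (A : Fin 3 → UnitAddTorus (Fin 3) → EuclideanSpace ℝ (Fin 3)), Literature.Analysis.FunctionSpaces.Torus.IsSmooth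 A₀ → Literature.Analysis.FunctionSpaces.Torus.IsSmooth A₄ → (∀ k, Literature.Analysis.FunctionSpaces.Torus.IsSmooth (A k)) → (∀ x, ‖A₀ x‖ ≤ β₀) → (∀ x, ‖A₄ x‖ ≤ β₀) → (∀ k x, ‖A k x‖ ≤ β₀) → ∀ δ : ℝ, 0 < δ → ∃ K₀ : ℝ, ∀ K ≥ K₀, ∀ R ≥ K₀, ∃ L₀ : ℝ, ∀ L ≥ L₀, ∃ k₀ : ℝ, ∀ k ≥ k₀, Filter.limsup (fun M : ℕ => P R σ' θ u ε Φ A₀ A₄ A K L k M) Filter.atTop ≤ (δ : EReal)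

/-- The crux IS the shell over the full pressure (definitional unfolding, no rewriting). -/
theorem crux_iff :
    Summit.AtomisticToContinuum.HydrodynamicLimit.Theses.BallwiseInvariantReferences.LocalFluxGibbsianity ↔
      PressureVanishes (pressureOf fullExponent) :=
  Iff.rfl

/-! ## The stubs -/

/-- **stub 1 — exponential Cauchy–Schwarz split** (TRUE analytic lemma; content = `G_M`-measurability
of the collision-resolved path functionals, i.e. progressive measurability of the càdlàg hard-sphere
flow on its good set, then Hölder `p = q = 2` and `√(ab) ≤ max(a,b)`, monotonicity of `(M+1)⁻¹ log`):
for every visibility scale `R` and all data, `Λ_M(X) ≤ max (Λ_M(2 X_vis)) (Λ_M(2 (X − X_vis)))`. -/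
theorem stub_exponentialCauchySchwarz :
    ∀ (R σ' θ : ℝ) (u : EuclideanSpace ℝ (Fin 3)) (ε : ℕ → ℝ) (Φ : FlowFamily ε)
      (A₀ A₄ : UnitAddTorus (Fin 3) → EuclideanSpace ℝ (Fin 3))
      (A : Fin 3 → UnitAddTorus (Fin 3) → EuclideanSpace ℝ (Fin 3)) (K L k : ℝ) (M : ℕ),
      pressureOf fullExponent σ' θ u ε Φ A₀ A₄ A K L k M ≤
        max (pressureOf (visExponent R) σ' θ u ε Φ A₀ A₄ A K L k M)
          (pressureOf (remExponent R) σ' θ u ε Φ A₀ A₄ A K L k M) := by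
  sorry

/-- **stub 2 — visible window pressure vanishes** (OPEN; the surviving content of the crux and the
candidate content of a repaired item): `∃ σ₀ ∀ box ∃ β₀ ∀ (σ', θ, u, ε, Φ, smooth fields of sup ≤ β₀)
∀ δ > 0 ∃ K₀ ∀ K ≥ K₀ ∀ R ≥ K₀ ∃ L₀ ∀ L ≥ L₀ ∃ k₀ ∀ k ≥ k₀: limsup_M (M+1)⁻¹ log ∫ exp(2 X_vis) dG_M ≤ δ`
— local flux-Gibbsianity of the VISIBLE (slow, locally dilute at scale `R`) particles around the
invariant Gibbs law: the ergodic input (zero excess Drude weight of the projected collision-resolved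
currents + bounded second-order response), free of the hard-core virial/entropy mismatch. -/
theorem stub_visibleWindowPressure : PressureVanishesR (fun R => pressureOf (visExponent R)) := by
  sorry

/-- **stub 3 — dense remainder pressure vanishes** (the REFUTED-ON-PAPER piece of the crux as filed;
kept because the crux is concluded by name and this is exactly what its repair must delete):
same shell for `2 (X − X_vis)`, the currents and collisional transfers of fast or locally dense
particles.  Standing paper witness (EVIDENCE.md 428ea41c, EVIDENCE_g2.md 243d99b9): a macroscopic
near-jammed cluster is entirely invisible, its collisional virial `≈ 3β₀θ/α'` per particle sits in
`X − X_vis` uncapped, at Gibbs cost `3 log(1/α') + 3 log(1/σ') + O(1)` ⇒ `limsup = +∞`.  Formal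
target for the disprover: `¬ stub_denseRemainderPressure` (Negative lemma, closes 13021 misstated). -/
theorem stub_denseRemainderPressure : PressureVanishesR (fun R => pressureOf (remExponent R)) := by
  sorry

/-! ## Composition (sorry-free) -/

/-- `limsup c ≤ δ` from `c ≤ max a b` pointwise and `limsup a, limsup b ≤ δ` (in `EReal`). -/
theorem limsup_le_of_le_max {a b c : ℕ → EReal} {δ : EReal}
    (h : ∀ M, c M ≤ max (a M) (b M)) (ha : Filter.limsup a Filter.atTop ≤ δ)
    (hb : Filter.limsup b Filter.atTop ≤ δ) : Filter.limsup c Filter.atTop ≤ δ :=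
  (Filter.limsup_le_limsup (Filter.Eventually.of_forall h)).trans
    (by rw [limsup_max]; exact max_le ha hb)

/-- Generic threshold bookkeeping: a pointwise `max`-split of `P` into two `R`-indexed families whose
pressures vanish in the `R`-shell gives the crux shell for `P` (`σ₀, β₀ := min`; `K₀, L₀, k₀ := max`;
`R := K`). -/
theorem pressureVanishes_of_split {P : PressureFamily} {V W : ℝ → PressureFamily}
    (hsplit : ∀ (R σ' θ : ℝ) (u : EuclideanSpace ℝ (Fin 3)) (ε : ℕ → ℝ) (Φ : FlowFamily ε)
      (A₀ A₄ : UnitAddTorus (Fin 3) → EuclideanSpace ℝ (Fin 3))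
      (A : Fin 3 → UnitAddTorus (Fin 3) → EuclideanSpace ℝ (Fin 3)) (K L k : ℝ) (M : ℕ),
      P σ' θ u ε Φ A₀ A₄ A K L k M ≤
        max (V R σ' θ u ε Φ A₀ A₄ A K L k M) (W R σ' θ u ε Φ A₀ A₄ A K L k M))
    (hV : PressureVanishesR V) (hW : PressureVanishesR W) : PressureVanishes P := by
  obtain ⟨σa, hσa, Ha⟩ := hV
  obtain ⟨σb, hσb, Hb⟩ := hW
  refine ⟨min σa σb, lt_min hσa hσb, ?_⟩
  intro σlo σhi θlo θhi U hσlo hσhi hθlo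
  obtain ⟨βa, hβa, Ha⟩ := Ha σlo σhi θlo θhi U hσlo (lt_of_lt_of_le hσhi (min_le_left _ _)) hθlo
  obtain ⟨βb, hβb, Hb⟩ := Hb σlo σhi θlo θhi U hσlo (lt_of_lt_of_le hσhi (min_le_right _ _)) hθlo
  refine ⟨min βa βb, lt_min hβa hβb, ?_⟩
  intro σ' hσ' θ hθ u hu ε hε hlim Φ A₀ A₄ A hA₀ hA₄ hA hbA₀ hbA₄ hbA δ hδ
  obtain ⟨Ka, Ha⟩ := Ha σ' hσ' θ hθ u hu ε hε hlim Φ A₀ A₄ A hA₀ hA₄ hA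
    (fun x => (hbA₀ x).trans (min_le_left _ _)) (fun x => (hbA₄ x).trans (min_le_left _ _))
    (fun j x => (hbA j x).trans (min_le_left _ _)) δ hδ
  obtain ⟨Kb, Hb⟩ := Hb σ' hσ' θ hθ u hu ε hε hlim Φ A₀ A₄ A hA₀ hA₄ hA
    (fun x => (hbA₀ x).trans (min_le_right _ _)) (fun x => (hbA₄ x).trans (min_le_right _ _))
    (fun j x => (hbA j x).trans (min_le_right _ _)) δ hδ
  refine ⟨max Ka Kb, fun K hK => ?_⟩
  have hKa : K ≥ Ka := le_trans (le_max_left _ _) hK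
  have hKb : K ≥ Kb := le_trans (le_max_right _ _) hK
  obtain ⟨La, Ha⟩ := Ha K hKa K hKa
  obtain ⟨Lb, Hb⟩ := Hb K hKb K hKb
  refine ⟨max La Lb, fun L hL => ?_⟩
  obtain ⟨ka, Ha⟩ := Ha L (le_trans (le_max_left _ _) hL)
  obtain ⟨kb, Hb⟩ := Hb L (le_trans (le_max_right _ _) hL)
  refine ⟨max ka kb, fun k hk => ?_⟩
  exact limsup_le_of_le_max (fun M => hsplit K σ' θ u ε Φ A₀ A₄ A K L k M)
    (Ha k (le_trans (le_max_left _ _) hk)) (Hb k (le_trans (le_max_right _ _) hk))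

/-- **Hypothesis form of the composition** (the registrar instruction's shape
`stub₁-sig → stub₂-sig → stub₃-sig → crux`, with the conclusion written as the crux's definitional
unfolding `PressureVanishes (pressureOf fullExponent)` — see `crux_iff` — so that exactly ONE theorem of
this file, `LocalFluxGibbsianity_of`, is headed by the crux constant, as `#h21_check_skeleton` wants). -/
theorem fullPressureVanishes_of
    (hsplit : ∀ (R σ' θ : ℝ) (u : EuclideanSpace ℝ (Fin 3)) (ε : ℕ → ℝ) (Φ : FlowFamily ε)
      (A₀ A₄ : UnitAddTorus (Fin 3) → EuclideanSpace ℝ (Fin 3))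
      (A : Fin 3 → UnitAddTorus (Fin 3) → EuclideanSpace ℝ (Fin 3)) (K L k : ℝ) (M : ℕ),
      pressureOf fullExponent σ' θ u ε Φ A₀ A₄ A K L k M ≤
        max (pressureOf (visExponent R) σ' θ u ε Φ A₀ A₄ A K L k M)
          (pressureOf (remExponent R) σ' θ u ε Φ A₀ A₄ A K L k M))
    (hvis : PressureVanishesR (fun R => pressureOf (visExponent R)))
    (hrem : PressureVanishesR (fun R => pressureOf (remExponent R))) :
    PressureVanishes (pressureOf fullExponent) :=
  pressureVanishes_of_split hsplit hvis hrem

/-- **The skeleton theorem**: the crux BY NAME from the three declared stubs BY NAME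
(`sorry` only inside `stub_*`; this declaration and everything else in the file are sorry-free). -/
theorem LocalFluxGibbsianity_of :
    Summit.AtomisticToContinuum.HydrodynamicLimit.Theses.BallwiseInvariantReferences.LocalFluxGibbsianity :=
  crux_iff.mpr (fullPressureVanishes_of stub_exponentialCauchySchwarz stub_visibleWindowPressure
    stub_denseRemainderPressure)

end Summit.AtomisticToContinuum.HydrodynamicLimit.Cruxes.LocalFluxGibbsianity.Birth

end
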